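import Summits.ResolutionOfSingularities.ResolutionOfSingularities.Theorems.EquisingularLiftEquisingularLiftNatTwoStepVertexA3
import Summits.ResolutionOfSingularities.ResolutionOfSingularities.Theorems.EquisingularLiftEquisingularLiftNatIsoHypPointOfPoints
import Summits.ResolutionOfSingularities.ResolutionOfSingularities.Theorems.EquisingularLiftEquisingularLiftNatTwoStepIsoHypPoint
import HarnessLib

/-!
# [OURS] AN `A₃` VERTEX AS THE ONLY SINGULAR POINT ⟹ `IsoHypPoint` (the lead's hypothesis #7 of the isolated residual) — the first SECOND-ORDER class
# of hypersurfaces certified in the route's own currency, every characteristic, every degree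
# (cruxes `Theses.EquisingularLift.EquisingularLiftNat` / `…NatThree`, stmt-ResolutionOfSingularities-20038 / -20148)

[OURS · leafhand-res-equisingularlift-11 g0, 2026-08-31; cell `pub/decomp-res`] AI-produced, weaker than expert review; NOT a statement of any manuscript;
nothing here proves resolution of singularities in positive characteristic.  DEF-FREE helper; no `sorry`; standard axioms; ZERO named hypotheses.

* ★★★ `isoHypPoint_of_A₃Vertex` — `K` algebraically closed, `F ∈ K[x₀,…,x₃]` a PRIME form, `c` a coordinate whose vertex chart is an `A₃` chart
  `F(x_c := 1) = y₀y₁ + ((y₂²(αy₀ + βy₁) + Ψ₁⁰) + (γy₂⁴ + Ψ₂⁰ + Ψ₅))` (`γ ≠ αβ`, `Ψ₁⁰ ∈ (y₀,y₁)²` cubic form, `Ψ₂⁰ ∈ (y₀,y₁)` quartic form, `Ψ₅ ∈ (y)⁵`),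
  singular at most at its origin (Jacobian hypothesis), with `V₊(F)` non-regular over `P_c` and every other vertex chart regular.  Then
  `IsoHypPoint K (1+2) V₊(F) ι`: the downstairs POINT chain resolves `V₊(F)` (two rounds: the `A₃` point, then the node over it).
  Assembly: ✓ `twoStepAt_vertex_A₃` (p834373, the two-step property at the vertex), ✓ `isoHypPoint_of_twoStepPoints` (leafhand-10), the vertex
  bookkeeping of ✓ `isoHypPoint_of_oneStepVertices` (kill map, `exists_vertexPoint`, regularity off the vertex by ✓ `MultiOrd.isRegularLocalRing_stalk_of_forall_exists`,
  the generic point) and ✓ `OrdPointAt.radical_span_dehomogenize_eq` (the chart of a prime form is radical).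

Honest label: closes no registered stub (the registered isolated residual carries `¬ IsoHypPoint`; this certifies the `A₃` surfaces it EXCLUDES).

References: [Hartshorne1977, I Thm. 5.1, I Ex. 5.6, II Ex. 7.12]; [StacksProject, Tag 080E]; through the cited tree files.
-/

set_option linter.dupNamespace false -- mandated namespace `Summit.<Summit>.<Problem>` of this single-conjunct summit

noncomputable section

open CategoryTheory CategoryTheory.Limits AlgebraicGeometry TopologicalSpace
open Literature.AlgebraicGeometry.Resolution Literature.AlgebraicGeometry.Motives
open AlgebraicGeometry.Scheme.IdealSheafData
open MvPolynomial HomogeneousLocalization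
open Literature.AlgebraicGeometry.Motives.SmoothHypersurface Literature.AlgebraicGeometry.Motives.ProjectiveSpace
open Summit.ResolutionOfSingularities.ResolutionOfSingularities.Cruxes.EquisingularLift.StrataSplit

namespace Summit.ResolutionOfSingularities.ResolutionOfSingularities.Cruxes.EquisingularLiftNat.Sections

/-- ★★★ **AN `A₃` VERTEX AS THE ONLY SINGULAR POINT ⟹ `IsoHypPoint`.** [OURS] [cite: Hartshorne1977, I Thm. 5.1, I Ex. 5.6] [cite: StacksProject, Tag 080E] -/
theorem isoHypPoint_of_A₃Vertex (K : Type) [Field K] [IsAlgClosed K] (F : MvPolynomial (Fin (1 + 2 + 1)) K) {d : ℕ} (hF : F.IsHomogeneous d)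
    (hFp : Prime F) (c : Fin (1 + 2 + 1)) (α β γ : K) (hdisc : γ ≠ α * β) {Ψ₁₀ Ψ₂₀ Ψ₅ : MvPolynomial (Fin 3) K}
    (hΨ₁₀h : Ψ₁₀.IsHomogeneous 3) (hΨ₁₀ : Ψ₁₀ ∈ Ideal.span {(X 0 : MvPolynomial (Fin 3) K), X 1} ^ 2)
    (hΨ₂₀h : Ψ₂₀.IsHomogeneous 4) (hΨ₂₀ : Ψ₂₀ ∈ Ideal.span {(X 0 : MvPolynomial (Fin 3) K), X 1})
    (hΨ₅ : Ψ₅ ∈ Ideal.span (Set.range (X : Fin 3 → MvPolynomial (Fin 3) K)) ^ 5)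
    (hdeh : ProjectiveSpace.dehomogenize K c F =
      X 0 * X 1 + ((X 2 ^ 2 * (C α * X 0 + C β * X 1) + Ψ₁₀) + (C γ * X 2 ^ 4 + Ψ₂₀ + Ψ₅)))
    (hsing : ∀ P : Ideal (MvPolynomial (Fin (1 + 2)) K), P.IsPrime → ProjectiveSpace.dehomogenize K c F ∈ P →
      (∀ j, pderiv j (ProjectiveSpace.dehomogenize K c F) ∈ P) → ∀ j, (X j : MvPolynomial (Fin (1 + 2)) K) ∈ P)
    (hsingpt : letI := MvPolynomial.gradedAlgebra (σ := Fin (1 + 2 + 1)) (R := K)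
      ∀ x : ↥(hypersurface F).left, (∀ a : Fin (1 + 2 + 1), a ≠ c →
        (X a : MvPolynomial (Fin (1 + 2 + 1)) K) ∈ ((hypersurfaceι F).left x).asHomogeneousIdeal) →
        ¬ IsRegularLocalRing ((hypersurface F).left.presheaf.stalk x))
    (hoff : letI := MvPolynomial.gradedAlgebra (σ := Fin (1 + 2 + 1)) (R := K)
      ∀ c', c' ≠ c → IsRegularRing (ChartRing F c' hF)) :
    letI := MvPolynomial.gradedAlgebra (σ := Fin (1 + 2 + 1)) (R := K)
    IsoHypPoint K (1 + 2) (hypersurface F).left (hypersurfaceι F).left := by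
  letI := MvPolynomial.gradedAlgebra (σ := Fin (1 + 2 + 1)) (R := K)
  letI := MvPolynomial.gradedAlgebra (σ := Fin (0 + 1)) (R := K)
  classical
  haveI := HypersurfaceSpecimen.isIntegral_hypersurface_of_prime K F hF hFp
  have hd : 0 < d := ConeN.pos_of_prime_of_isHomogeneous K F hF hFp
  have hιinj : Function.Injective (hypersurfaceι F).left := (hypersurfaceι F).left.isClosedEmbedding.injective
  -- `Φ = y₀y₁`, `Ψ =` the rest
  have hΦ : (X 0 * X 1 : MvPolynomial (Fin 3) K).IsHomogeneous 2 := by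
    simpa using (isHomogeneous_X K (0 : Fin 3)).mul (isHomogeneous_X K (1 : Fin 3))
  obtain ⟨hΨ, -⟩ := SecondOrderPoint.twoStepData_A₃ K α β γ hdisc hΨ₁₀h hΨ₁₀ hΨ₂₀h hΨ₂₀ hΨ₅
  have hrad : (Ideal.span {(X 0 * X 1 + ((X 2 ^ 2 * (C α * X 0 + C β * X 1) + Ψ₁₀) + (C γ * X 2 ^ 4 + Ψ₂₀ + Ψ₅)) :
      MvPolynomial (Fin 3) K)}).radical =
      Ideal.span {(X 0 * X 1 + ((X 2 ^ 2 * (C α * X 0 + C β * X 1) + Ψ₁₀) + (C γ * X 2 ^ 4 + Ψ₂₀ + Ψ₅)) : MvPolynomial (Fin 3) K)} :=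
    OrdPointAt.radical_span_dehomogenize_eq K F c hF hFp (X 0 * X 1) _ hΦ (by norm_num) hΨ hdeh
  have hrad' : (Ideal.span {ProjectiveSpace.dehomogenize K c F}).radical = Ideal.span {ProjectiveSpace.dehomogenize K c F} := by
    rw [hdeh]; exact hrad
  -- the two-step vertex
  obtain ⟨x₀, hx₀cl', hx₀X, htwo⟩ :=
    twoStepAt_vertex_A₃ K F hF hd c α β γ hdisc hΨ₁₀h hΨ₁₀ hΨ₂₀h hΨ₂₀ hΨ₅ hdeh hrad
  -- the kill map of `P_c` and the vertex bookkeeping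
  have he : Function.Injective (fun _ : Fin 1 => c) := Function.injective_of_subsingleton _
  have hec : ∀ j : Fin 1, (fun _ : Fin 1 => c) j = c := fun _ => rfl
  obtain ⟨fk, hfk', hfkC, hfke, hfk0⟩ := LinearCentre.exists_kill (R := K) (fun _ : Fin 1 => c) he
  have hfke' : ∀ j : Fin 1, fk (X c) = X j := fun j => hfke j
  have hfk0' : ∀ i : Fin (1 + 2 + 1), i ≠ c → fk (X i) = 0 := fun i hi => hfk0 i (fun ⟨_, hj⟩ => hi hj.symm)
  obtain ⟨x₁, hx₁cl, hx₁cl', hsupp, hx₁X, hΛ, hcomap⟩ :=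
    exists_vertexPoint K F hF c ⟨2, X 0 * X 1, _, by norm_num, hΦ, hΨ, hdeh⟩ fk hfk' hfkC hfke' hfk0'
  -- `x₀ = x₁`: both lie over the vertex
  have hx₀supp : (hypersurfaceι F).left x₀ ∈ ((Proj.map fk hfk').ker.support : Set (Proj (homogeneousSubmodule (Fin (1 + 2 + 1)) K))) := by
    by_contra h
    obtain ⟨a, ha, hXa⟩ := LinearCentre.exists_X_not_mem_of_not_mem_support (fun _ : Fin 1 => c) he fk hfk' hfkC hfke hfk0 h
    exact hXa (hx₀X a ((OrdPointAt.not_mem_range_iff c hec a).mp ha))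
  have hx₀₁ : x₀ = x₁ := by
    rw [hsupp] at hx₀supp
    exact hιinj (Set.mem_singleton_iff.mp hx₀supp)
  subst hx₀₁
  -- the generic point
  obtain ⟨ξ, hξ⟩ : ∃ ξ : ↥(hypersurface F).left, (hypersurfaceι F).left ξ = pointOfPrime F hF hFp := by
    have h : (pointOfPrime F hF hFp : Proj (homogeneousSubmodule (Fin (1 + 2 + 1)) K)) ∈ Set.range (hypersurfaceι F).left := by
      refine (Set.ext_iff.mp (range_hypersurfaceι F) _).mpr ((ProjectiveSpectrum.mem_zeroLocus _ _ _).mpr (Set.singleton_subset_iff.mpr ?_))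
      exact Ideal.subset_span rfl
    exact h
  refine isoHypPoint_of_twoStepPoints K (1 + 2) (hypersurface F).left (hypersurfaceι F).left ∅ {x₀} ?_ ?_ ?_ ?_ ?_ ξ ?_
  · -- closed images
    rintro x (hx | hx)
    · exact absurd hx (Finset.notMem_empty x)
    · rw [Finset.mem_singleton] at hx; subst hx; exact hx₁cl
  · -- non-regular
    rintro x (hx | hx)
    · exact absurd hx (Finset.notMem_empty x)
    · rw [Finset.mem_singleton] at hx; subst hx; exact hsingpt x hx₀X
  · -- regular off the vertex
    intro x _ hx
    rw [Finset.mem_singleton] at hx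
    refine MultiOrd.isRegularLocalRing_stalk_of_forall_exists K F hF hd [c] (fun c' hc' => ?_)
      (fun c' hc' => hoff c' (fun h => hc' (by rw [h]; exact List.mem_singleton_self c))) x (fun c' hc' => ?_)
    · rw [List.mem_singleton] at hc'; subst hc'; exact ⟨hrad', hsing⟩
    · rw [List.mem_singleton] at hc'; subst hc'
      have hxc : (hypersurfaceι F).left x ∉ ((Proj.map fk hfk').ker.support : Set (Proj (homogeneousSubmodule (Fin (1 + 2 + 1)) K))) := by
        rw [hsupp]
        intro h
        exact hx (hιinj (Set.mem_singleton_iff.mp h))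
      obtain ⟨a, ha, hXa⟩ := LinearCentre.exists_X_not_mem_of_not_mem_support (fun _ : Fin 1 => c') he fk hfk' hfkC hfke hfk0 hxc
      exact ⟨a, (OrdPointAt.not_mem_range_iff c' hec a).mp ha, (Proj.mem_basicOpen _ _ _).mpr hXa⟩
  · -- one-step points: none
    intro x hx
    exact absurd hx (Finset.notMem_empty x)
  · -- the two-step vertex
    intro x hx hxcl Z τ hτ
    rw [Finset.mem_singleton] at hx
    subst hx
    exact htwo Z τ hτ
  · -- the generic point is not the vertex
    rintro x (hx | hx) h
    · exact absurd hx (Finset.notMem_empty x)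
    · rw [Finset.mem_singleton] at hx
      subst hx
      obtain ⟨a, hac, ha⟩ := MultiOrd.exists_X_ne_not_mem_span K F hFp c
      have hmem : (hypersurfaceι F).left ξ ∈ ((Proj.map fk hfk').ker.support : Set (Proj (homogeneousSubmodule (Fin (1 + 2 + 1)) K))) := by
        rw [hsupp, ← h]; rfl
      rw [hξ] at hmem
      exact ha (LinearCentre.X_mem_asHomogeneousIdeal_of_mem_support (fun _ : Fin 1 => c) fk hfk' hfkC hfke hfk0 hmem
        (fun ⟨_, hj⟩ => hac hj.symm))

end Summit.ResolutionOfSingularities.ResolutionOfSingularities.Cruxes.EquisingularLiftNat.Sections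

end
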